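import Summits.BirchSwinnertonDyer.Rank1Residual.Additive.ChiBranchConstantTerm
import Summits.BirchSwinnertonDyer.Rank1Residual.Additive.ChiBranchInputOdd
import Literature.NumberTheory.EllipticCurves.PAdicLFunctionMinusDistributionProofs
import HarnessLib

/-!
# The ODD `χ_p`-branch at `T = 0`: `L_p(f, α, ω^{(p−1)/2}, 0)` via the MINUS symbols equals
# `α⁻¹ ∑_{a mod p} (a/p) [a/p]⁻_f` (cell `b2b-bsdres`, seat additive-p4, lines V9/V14, link [D⁻])

HONEST FRAMING (cell `b2b-bsdres`, run/shared/lean/b2b/bsd-rank1-residual/, verbatim in every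
file): the goal of the cell is to DELETE the COMBINATION-SHAPED residual classes of the
Birch–Swinnerton-Dyer formula for ALL analytic-rank `≤ 1` elliptic curves over `ℚ` — "full BSD
formula for every rank `≤ 1` curve in class `C`" assembled STRICTLY from published theorems — so
that the rank-`≤ 1` remainder becomes exactly the CONSTRUCTION-SHAPED classes, which are TYPED
(missing-input `Prop`s), NOT attempted. This is not "finishing BSD". Seat additive-p4; research route
on X3/X4; no label is changed by this file.

Theorems only. The ODD twin of `ChiBranchConstantTerm.lean` (p203266): for a prime `p ≠ 2`, the
newform `f` of a GOOD ORDINARY `V/ℚ` and its unit root `α`, the constant term of the MINUS branch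
`padicLFunctionMinusBranch f α ((p−1)/2)` is `α⁻¹ · legendreMinusSymbolSum f p =
α⁻¹ ∑_{a mod p} (a/p) [a/p]⁻_f` (`constantCoeff_padicLFunctionMinusBranch_half`). Ingredients, all
PROVED in the tree: the distribution relation of `μ⁻_{f,α}` and the finite-sum formula for the
constant term (`PAdicLFunctionMinusDistributionProofs`, this seat), Euler's criterion for the
Teichmüller character `ω(a)^{(p−1)/2} = (a/p)` (`teichRep_pow_half_eq_legendreSym`), and `[0]⁻_f = 0`
(so the error term `α⁻²[a]⁻_f` of the measure VANISHES identically — no `∑(a/p) = 0` is needed).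
At `p = 3` this is exactly the hypothesis `hD1` of `X3RankZeroCyclotomicThree.lean` (line V14), which
is thereby DISCHARGED (`constantCoeff_padicLFunctionMinusBranch_one_three`).

References: Mazur–Tate–Teitelbaum 1986 §I.10 (10.1), §I.13, §I.14 [MazurTateTeitelbaum1986Invent].
-/

noncomputable section

open scoped Classical MatrixGroups ModularForm

open CongruenceSubgroup WeierstrassCurve Literature.NumberTheory.EllipticCurves
  Literature.NumberTheory.EllipticCurves.ModularForms

namespace Summit.BirchSwinnertonDyer.Rank1Residual.Additive

variable (p : ℕ) [hp : Fact p.Prime]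

variable {p} in
/-- The MINUS MSD measure at level `e = n + 1` (equation lemma with the level abstracted; twin of
`msdMeasure_of_eq_succ`). [cite: MazurTateTeitelbaum1986Invent, §I.10 (10.1)] -/
theorem msdMinusMeasure_of_eq_succ {N : ℕ} (f : CuspForm (Gamma0 N) 2) (α : ℚ_[p]) {e n : ℕ}
    (h : e = n + 1) (a : ZMod (p ^ e)) :
    msdMinusMeasure f α e a =
      α⁻¹ ^ (n + 1) * (ratMinusSymbol f ((a.val : ℚ) / (p : ℚ) ^ (n + 1)) : ℚ_[p]) -
        α⁻¹ ^ (n + 2) * (ratMinusSymbol f ((a.val : ℚ) / (p : ℚ) ^ n) : ℚ_[p]) := by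
  subst h
  rfl

/-- **The distribution relation of `μ⁻_{f,α}` for the newform of a good ordinary curve and its unit
root** (`sum_fiber_msdMinusMeasure_succ_eq_of_coeffField` with the tree's `IsNewformOf` API: rational
coefficients, `p ∤ N`, `a_p(f) = a_p(V)`, `α² − a_p α + p = 0`).
[cite: MazurTateTeitelbaum1986Invent, §I.10 Prop. (10.2)] -/
theorem msdMinusMeasure_distribution_of_isNewformOf {N : ℕ} [NeZero N] {f : CuspForm (Gamma0 N) 2}
    (V : WeierstrassCurve ℚ) [V.IsElliptic] [V.IsGloballyMinimal] (hord : IsOrdinaryAt V p)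
    (hf : IsNewformOf V f) (n : ℕ) (a : ZMod (p ^ n)) :
    ∑ b ∈ Finset.univ.filter (fun b : ZMod (p ^ (n + 1)) ↦
        ZMod.castHom (pow_dvd_pow p n.le_succ) (ZMod (p ^ n)) b = a),
      msdMinusMeasure f (unitRoot V p : ℚ_[p]) (n + 1) b = msdMinusMeasure f (unitRoot V p : ℚ_[p]) n a := by
  obtain ⟨hαeq, -, hα0⟩ := unitRoot_coe_spec (W := V) hord
  exact sum_fiber_msdMinusMeasure_succ_eq_of_coeffField hf.1 hf.coeffField_eq_bot
    (not_dvd_level_of_isNewformOf hf hord.1) (cuspCoeff_eq_frobeniusTrace_of_isNewformOf_holds hf hord.1)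
    hα0 hαeq n a

/-- **[D⁻] The ODD `χ_p`-branch at `T = 0` (PROVED).** For `p ≠ 2`, `f` the newform of a good
ordinary `V` and `α = unitRoot V p`:
`constantCoeff (padicLFunctionMinusBranch f α ((p−1)/2)) = α⁻¹ · ∑_{a mod p} (a/p)·[a/p]⁻_f`
(`= α⁻¹ · legendreMinusSymbolSum f p`). Proof: the constant term is
`∑_{a ∈ (ℤ/p)ˣ} μ⁻(a + pℤ_p) ω(a)^{(p−1)/2}` (`constantCoeff_padicLFunctionMinusBranch_eq`);
`μ⁻(a + pℤ_p) = α⁻¹[a/p]⁻ − α⁻²[a]⁻ = α⁻¹[a/p]⁻` since `[a]⁻ = [0]⁻ = 0`; `ω(a)^{(p−1)/2} = (a/p)`.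
Odd twin of `constantCoeff_padicLFunctionBranch_half` (there the error term needed `∑(a/p) = 0`; here it
is identically zero). [cite: MazurTateTeitelbaum1986Invent, §I.13–I.14] -/
theorem constantCoeff_padicLFunctionMinusBranch_half (hp2 : p ≠ 2) {N : ℕ} [NeZero N]
    {f : CuspForm (Gamma0 N) 2} (V : WeierstrassCurve ℚ) [V.IsElliptic] [V.IsGloballyMinimal]
    (hord : IsOrdinaryAt V p) (hf : IsNewformOf V f) :
    PowerSeries.constantCoeff (padicLFunctionMinusBranch f (unitRoot V p : ℚ_[p]) (p / 2)) =
      (unitRoot V p : ℚ_[p])⁻¹ * (legendreMinusSymbolSum f p : ℚ_[p]) := by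
  classical
  have hpP : p.Prime := hp.out
  have he : cyclotomicExponent p = 0 + 1 := by rw [zero_add]; exact cyclotomicExponent_eq_one p hp2
  set α : ℚ_[p] := (unitRoot V p : ℚ_[p]) with hα
  rw [constantCoeff_padicLFunctionMinusBranch_eq (msdMinusMeasure_distribution_of_isNewformOf p V hord hf)
    (p / 2)]
  -- the summand: `μ⁻(a + pℤ_p) ω(a)^{(p-1)/2} = α⁻¹ (a/p) [a/p]⁻` (the `[a]⁻ = [0]⁻ = 0` term vanishes)
  have hsummand : ∀ a : (ZMod (p ^ cyclotomicExponent p))ˣ,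
      msdMinusMeasure f α (cyclotomicExponent p) (a : ZMod (p ^ cyclotomicExponent p)) *
          ((((teichRep p a : rootsOfUnity (torsionOrder p) ℤ_[p]) : ℤ_[p]ˣ) : ℤ_[p]) : ℚ_[p]) ^
            (p / 2) =
        α⁻¹ * (((legendreSym p ((a : ZMod (p ^ cyclotomicExponent p)).val : ℤ)) : ℚ_[p]) *
            (ratMinusSymbol f (((a : ZMod (p ^ cyclotomicExponent p)).val : ℚ) / p) : ℚ_[p])) := by
    intro a
    have hteich : ((((teichRep p a : rootsOfUnity (torsionOrder p) ℤ_[p]) : ℤ_[p]ˣ) : ℤ_[p]) :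
        ℚ_[p]) ^ (p / 2) =
        (legendreSym p ((a : ZMod (p ^ cyclotomicExponent p)).val : ℤ) : ℚ_[p]) := by
      rw [← PadicInt.coe_pow, teichRep_pow_half_eq_legendreSym p hp2 a, PadicInt.coe_intCast]
    have hzero : ratMinusSymbol f (((a : ZMod (p ^ cyclotomicExponent p)).val : ℚ) / (p : ℚ) ^ 0) = 0 := by
      rw [pow_zero, div_one]
      have h := ratMinusSymbol_add_intCast f 0 ((a : ZMod (p ^ cyclotomicExponent p)).val : ℤ)
      rw [ratMinusSymbol_zero, zero_add] at h
      exact_mod_cast h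
    rw [hteich, msdMinusMeasure_of_eq_succ f α he, hzero, zero_add, pow_one]
    push_cast
    ring
  rw [Fintype.sum_congr _ _ hsummand, ← Finset.mul_sum]
  congr 1
  rw [sum_units_cyclotomicExponent_eq p hp2
    (fun n : ℕ ↦ ((legendreSym p (n : ℤ) : ℚ_[p]) * (ratMinusSymbol f ((n : ℚ) / p) : ℚ_[p])))
    (fun n hn ↦ by
      rw [(legendreSym.eq_zero_iff p (n : ℤ)).mpr (by exact_mod_cast (ZMod.natCast_eq_zero_iff n p).mpr hn)]
      push_cast
      ring)]
  rw [legendreMinusSymbolSum_def]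
  push_cast
  rfl

/-- **At `p = 3`**: `constantCoeff (padicLFunctionMinusBranch f α 1) = α⁻¹ · legendreMinusSymbolSum f 3`
for the newform `f` of a good ordinary `V` at `3` — EXACTLY the hypothesis `hD1` of
`X3CyclotomicThree.exists_padicVal_shaOrder_add_le` (`X3RankZeroCyclotomicThree.lean`, line V14), now a
theorem. [cite: MazurTateTeitelbaum1986Invent, §I.13–I.14] -/
theorem constantCoeff_padicLFunctionMinusBranch_one_three {N : ℕ} [NeZero N]
    {f : CuspForm (Gamma0 N) 2} (V : WeierstrassCurve ℚ) [V.IsElliptic] [V.IsGloballyMinimal]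
    (hord : IsOrdinaryAt V 3) (hf : IsNewformOf V f) :
    PowerSeries.constantCoeff (padicLFunctionMinusBranch f ((unitRoot V 3 : ℤ_[3]) : ℚ_[3]) 1) =
      (((unitRoot V 3 : ℤ_[3]) : ℚ_[3]))⁻¹ * (legendreMinusSymbolSum f 3 : ℚ_[3]) := by
  have h := constantCoeff_padicLFunctionMinusBranch_half 3 (by norm_num) V hord hf
  exact h

end Summit.BirchSwinnertonDyer.Rank1Residual.Additive

end
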